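import Literature.MathematicalPhysics.QuantumFieldTheory.King1986.SlicePropagatorStatementsAt
import Summits.QuantumFields.YangMills.Theorems.BalabanUVNodesN15KingModelProp37AtRegularFieldBoxHolder

/-!
# N15 (NE2⁺, row s3 KING-MODEL ∕ RIEMANN-KERNEL RUNG) — PART Ζ-e₂: KING 1986 PROPOSITION 3.7 BY NAME FOR `G^η_{(j)}(Ω′, A^{(k)})` — A REGULAR
# BACKGROUND ON A BIG-BLOCK INTERVAL BOX `Ω′ ⊂ T_ε`, regularity required ON `Ω′` ONLY (p. 665 «Proposition 3.7 also holds for G_(j)(Ω′) and G_(j)(Ω′, A^{(k)})»)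

count-neutral helper of the pub-ymgap K3⁸ programme (`--supports stmt-QuantumFields-27366`); nothing here is a claim about Bałaban's
non-abelian `G(U)`, the continuum, ℝ⁴, OS axioms, a mass gap or the Clay problem.  One finite torus `T_ε` at fixed `ε`.

## What is printed

[King1986] = C. King, CMP **102** (1986) 649–677, Prop. 3.7 (3.62)–(3.65) p. 663 (quoted in PART Ζ-a) and p. 665 [PDF 17] l. 22–23: *"We note
that Proposition 3.7 also holds for G^η_{(j)}(Ω′) and G^η_{(j)}(Ω′, A^{(k)}), since Theorem 3.3 gives bounds on these operators also."* — `Ω′` a cube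
which is a union of large blocks (p. 661), `A^{(k)}` regular on it.  [Balaban1983Higgs3] (2.10)–(2.11) p. 426 on a box: [Balaban1982Higgs1] p. 611 l. 1–2
*"For some simple sets Ω, e.g. for rectangular parallelepipeds, the inequalities hold without any restrictions on the points x, x′"* — PROVED in the
tree by lit-balaban p26 for the pieces `G^η_{(j)}(Ω, A)` of (I.2.43) of the REGION operators on every cell-product box, regularity of `A` required
on the box only: `B3Ineq211RegularBoxCarrier.ineq210_and_211At_regularBoxH_small` (carrier `regBoxKernelsH`).

## What this file proves

(PART Ζ-e₁ `…Prop37AtRegularFieldBoxHolder`: the transport-free Hölder lines on the box — `absG_holder_le_box`, `absDG_holder_le_box`.)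
* §3 def `kingSliceKernelsRegBox hP1 C lo hi A m² a k K₀ : SliceKernels P.d` — King's datum for `G^η_{(j)}(Ω′, A)`: sites = the BOND-CLOSED points
  `bset Ω′` of the interval box `Ω′ = Π_μ[lo_μK₀L^k, hi_μK₀L^k)` (g21 `bset`: all `d` forward bonds inside, so every `∂^η_μ` of (3.63)₂∕(3.65)₂ is a
  derivative of the Neumann operator of `Ω′`), King's units as in PART Ζ-b, `B = PEmpty`; ★★ `prop37PrintedAt_box_of` (transfer);
  ★★★ **`prop37PrintedAt_king_regularField_box`**: `∃ K₀min, ∀ α ∈ (0,1), ∀ K₀ ≥ K₀min, ∃ t C δ₀ > 0, ∀ volume P (P.d = d, P.L = L, K₀ ∣ M), ∀ 1 ≤ k ≤ K_P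
  with 3L^kK₀ ≤ |T_ε|_μ, L^kε ≤ 1, ∀ interval box with sides ≤ half the torus, ∀ A δ_A-regular ON THE BOX with L^kδ_A|e| ≤ t:
  Prop37PrintedAt α (kingSliceKernelsRegBox …) C δ₀`; ★★★ `prop37KingOrder_king_flatOnBox` (fields lattice-constant ON THE BOX — arbitrary outside).

HONEST SCOPE.  Block-norm reading (PART Ζ-a); interval boxes of r14∕p26's cell family with sides ≤ half the torus (so the coordinate staircases stay
inside); sites restricted to the bond-closed layer `bset Ω′` (one fine site short of `Ω′` in each forward direction); (3.64) empty by type here (the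
vector clause is PART Ζ-d's, on the torus); constants per `(α, K₀)`; `m² > 0`.  NOT an η-rate; NE2⁺ for Bałaban's `G(U)` NOT proved; N15 NOT discharged.
Unit `pub-ymgap-dag-n15-e` g22 (R141 (C) s3), PART Ζ-e₂.
-/

noncomputable section

open scoped BigOperators

namespace Summit.QuantumFields.YangMills.BalabanUVNodes.N15KingModelRung.RegularField

open Literature.MathematicalPhysics.QuantumFieldTheory.Balaban1983to89
open Literature.MathematicalPhysics.QuantumFieldTheory.Balaban1983to89.HiggsLattice (ChargeData ScalarField covDeriv)
open Literature.MathematicalPhysics.QuantumFieldTheory.Balaban1983to89.B1Eq230FluctCov (Ix cb)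
open Literature.MathematicalPhysics.QuantumFieldTheory.Balaban1983to89.B1Ineq234LevelZero (tdist_comm tdist_triangle_real)
open Literature.MathematicalPhysics.QuantumFieldTheory.Balaban1983to89.B1TorusChainTransport (IsTChain TNbr hol norm_hol_apply tdist_mem_chain_le)
open Literature.MathematicalPhysics.QuantumFieldTheory.Balaban1983to89.B2Restr216Lattice (norm_U_apply)
open Literature.MathematicalPhysics.QuantumFieldTheory.Balaban1983to89.B4GaugeCovariance (pathEnd)
open Literature.MathematicalPhysics.QuantumFieldTheory.Balaban1983to89.B3Sect2StatementsPart2 (ScaledKernels)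
open Literature.MathematicalPhysics.QuantumFieldTheory.Balaban1983to89.B1TorusCubeCover (half)
open Literature.MathematicalPhysics.QuantumFieldTheory.Balaban1983to89.B1Ineq225RegularBox (cellBox)
open Literature.MathematicalPhysics.QuantumFieldTheory.Balaban1983to89.B3Ineq210RegularRegion (pieceR)
open Literature.MathematicalPhysics.QuantumFieldTheory.Balaban1983to89.B3Ineq210RegularTorus (mesh_eq_pow_mul)
open Literature.MathematicalPhysics.QuantumFieldTheory.Balaban1983to89.B3Ineq210RegularBox (regBoxKernels scaleB_eq)
open Literature.MathematicalPhysics.QuantumFieldTheory.Balaban1983to89.B3Ineq211RegularTorus (IsAdm one_le_tdist_of_ne')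
open Literature.MathematicalPhysics.QuantumFieldTheory.Balaban1983to89.B3Ineq211RegularRegion (holderTermR)
open Literature.MathematicalPhysics.QuantumFieldTheory.Balaban1983to89.B3Ineq211RegularBoxCarrier (regBoxKernelsH ineq210_iff_BH scaleBH_eq
  holderTermR_le_holderDiffB ineq210_and_211At_regularBoxH_small)
open Literature.MathematicalPhysics.QuantumFieldTheory.King1986.SlicePropagator (SliceKernels holderDeriv Prop37PrintedAt Prop37KingOrder)
open Literature.MathematicalPhysics.QuantumFieldTheory.King1986 (ContinuumLimit.eps)
open Summit.QuantumFields.YangMills.BalabanUVNodes.N15KingModelRung.Curved (VSite bset mem_bset legsK legsK_isAdm legsK_subset_intervalBox)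

variable {P : HiggsLattice.Params} {N : ℕ}

/-! ## §3 King's datum for `G^η_{(j)}(Ω′, A)` on the bond-closed sites of an interval box; Proposition 3.7 BY NAME -/

/-- ★ **KING's PROP-3.7 DATUM FOR `G^η_{(j)}(Ω′, A)`** — `Ω′ = Π_μ[lo_μK₀L^k, hi_μK₀L^k) ⊂ T_ε` an interval box of big blocks, sites its bond-closed layer
`bset Ω′`, King's units (`η = L^{−k}`): `dist x y = L^{−k}|x − y|`, `G j x y = (L^kε)^{d−2}·|G_(j)(Ω′,A;x,y)|`, `dG j μ x y = (L^kε)^{d−1}·|(D_{A,μ}G_(j)(Ω′,A))(x,y)|`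
(p26's box carrier `regBoxKernels`), `B = PEmpty`. [cite: King1986, Prop 3.7 p.663, p.665 «also holds for G_(j)(Ω′, A^{(k)})»] [cite: Balaban1983Higgs3, (2.6) p.424, (2.10) p.426] -/
def kingSliceKernelsRegBox (hP1 : 1 < P.L) (C : ChargeData N) (lo hi : Fin P.d → ℕ) (A : HiggsLattice.VecField P 0) (msq a : ℝ)
    (k K₀ : ℕ) : SliceKernels P.d where
  S := VSite (bset (cellBox k K₀ (fun μ => Finset.Ico (lo μ) (hi μ))))
  B := PEmpty
  dist x y := (HiggsLattice.Site.tdist x.1 y.1 : ℝ) / (P.L : ℝ) ^ k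
  distBlockBond _ _ b := b.elim
  L := P.L
  k := k
  G j x y := P.mesh k ^ ((P.d : ℝ) - 2) *
    (regBoxKernels hP1 C (fun μ => Finset.Ico (lo μ) (hi μ)) A msq a k K₀).absG j ⟨x.1, (mem_bset.1 x.2).1⟩ ⟨y.1, (mem_bset.1 y.2).1⟩
  dG j μ x y := P.mesh k ^ ((P.d : ℝ) - 1) *
    (regBoxKernels hP1 C (fun μ => Finset.Ico (lo μ) (hi μ)) A msq a k K₀).absDG j μ ⟨x.1, (mem_bset.1 x.2).1⟩ ⟨y.1, (mem_bset.1 y.2).1⟩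
  Gc _ _ b := b.elim

section MainBox

variable {hP1 : 1 < P.L} {C : ChargeData N} {lo hi : Fin P.d → ℕ} {A : HiggsLattice.VecField P 0} {msq a : ℝ} {k K₀ : ℕ}

/-- King's slice length: `L^jη = (L^jε)/(L^kε)`. [cite: King1986, (3.63) p.663] -/
theorem slice_box (j : ℕ) : (kingSliceKernelsRegBox hP1 C lo hi A msq a k K₀).slice j = P.mesh j / P.mesh k := by
  show (P.L : ℝ) ^ j * ContinuumLimit.eps P.L k = P.mesh j / P.mesh k
  unfold ContinuumLimit.eps
  rw [mesh_eq_pow_mul P j, mesh_eq_pow_mul P k, mul_div_mul_right _ _ (P.mesh_pos 0).ne', div_eq_mul_inv]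

/-- King's distance: `L^{−k}|x − y| = (ε|x − y|)/(L^kε)`. [cite: King1986, (3.62) p.663] -/
theorem dist_box (x y : VSite (bset (cellBox k K₀ (fun μ => Finset.Ico (lo μ) (hi μ))))) :
    (kingSliceKernelsRegBox hP1 C lo hi A msq a k K₀).dist x y = (P.mesh 0 * (HiggsLattice.Site.tdist x.1 y.1 : ℝ)) / P.mesh k := by
  show (HiggsLattice.Site.tdist x.1 y.1 : ℝ) / (P.L : ℝ) ^ k = _
  rw [mesh_eq_pow_mul P k, mul_comm ((P.L : ℝ) ^ k), mul_div_mul_left _ _ (P.mesh_pos 0).ne']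

/-- exponent conversion. [cite: King1986, (3.63) p.663] -/
theorem rate_conv_box (δ t : ℝ) (j : ℕ) :
    δ * ((kingSliceKernelsRegBox hP1 C lo hi A msq a k K₀).slice j)⁻¹ * (P.mesh 0 * t / P.mesh k) = δ * (P.mesh j)⁻¹ * (P.mesh 0 * t) := by
  rw [slice_box]
  have hk : P.mesh k ≠ 0 := (P.mesh_pos k).ne'
  have hj : P.mesh j ≠ 0 := (P.mesh_pos j).ne'
  field_simp

/-- scaling `(L^kε)^{d−2+β}(L^jε)^{2−d−β} = (L^jη)^{2−d−β}`. [cite: King1986, (2.20) p.654, (3.63) p.663] -/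
theorem scaling_two_box (β : ℝ) (j : ℕ) :
    P.mesh k ^ ((P.d : ℝ) - 2 + β) * P.mesh j ^ ((2 : ℝ) - (P.d : ℝ) - β)
      = ((kingSliceKernelsRegBox hP1 C lo hi A msq a k K₀).slice j) ^ ((2 : ℝ) - (P.d : ℝ) - β) := by
  rw [slice_box, Real.div_rpow (P.mesh_pos j).le (P.mesh_pos k).le, div_eq_mul_inv, ← Real.rpow_neg (P.mesh_pos k).le, mul_comm]
  congr 1; congr 1; ring

/-- scaling `(L^kε)^{d−1+β}(L^jε)^{1−d−β} = (L^jη)^{1−d−β}`. [cite: King1986, (2.20) p.654, (3.63) p.663] -/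
theorem scaling_one_box (β : ℝ) (j : ℕ) :
    P.mesh k ^ ((P.d : ℝ) - 1 + β) * P.mesh j ^ ((1 : ℝ) - (P.d : ℝ) - β)
      = ((kingSliceKernelsRegBox hP1 C lo hi A msq a k K₀).slice j) ^ ((1 : ℝ) - (P.d : ℝ) - β) := by
  rw [slice_box, Real.div_rpow (P.mesh_pos j).le (P.mesh_pos k).le, div_eq_mul_inv, ← Real.rpow_neg (P.mesh_pos k).le, mul_comm]
  congr 1; congr 1; ring

/-- the Hölder weight in King's units: `(L^{−k}|x−y|)^{−α}(ε|x−y|)^α = (L^kε)^α` (`x ≠ y`). [cite: King1986, (3.62) p.663] -/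
theorem holderWeight_conv_box {α : ℝ} {x y : VSite (bset (cellBox k K₀ (fun μ => Finset.Ico (lo μ) (hi μ))))} (hxy : x.1 ≠ y.1) :
    ((kingSliceKernelsRegBox hP1 C lo hi A msq a k K₀).dist x y) ^ (-α) * (P.mesh 0 * (HiggsLattice.Site.tdist x.1 y.1 : ℝ)) ^ α
      = P.mesh k ^ α := by
  rw [dist_box]
  have hr : 0 < P.mesh 0 * (HiggsLattice.Site.tdist x.1 y.1 : ℝ) := by
    have : (1 : ℝ) ≤ HiggsLattice.Site.tdist x.1 y.1 := by exact_mod_cast one_le_tdist_of_ne' (Ne.symm hxy)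
    have := P.mesh_pos 0
    positivity
  rw [Real.rpow_neg (div_nonneg hr.le (P.mesh_pos k).le), Real.div_rpow hr.le (P.mesh_pos k).le, inv_div,
    div_mul_cancel₀ _ (Real.rpow_pos_of_pos hr α).ne']

/-- positivity of King's distance forces distinct fine sites. [cite: Balaban1982Higgs1, (1.3) p.604] -/
theorem ne_of_dist_pos_box {x y : VSite (bset (cellBox k K₀ (fun μ => Finset.Ico (lo μ) (hi μ))))}
    (h : 0 < (kingSliceKernelsRegBox hP1 C lo hi A msq a k K₀).dist x y) : x.1 ≠ y.1 := by
  intro hxy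
  have : (kingSliceKernelsRegBox hP1 C lo hi A msq a k K₀).dist x y = 0 := by
    show (HiggsLattice.Site.tdist x.1 y.1 : ℝ) / (P.L : ℝ) ^ k = 0
    rw [hxy, B1Ineq234Concrete.tdist_self]; simp
  rw [this] at h; exact lt_irrefl _ h

/-- `min` versus King's rescaling. [folklore] -/
theorem min_dist_conv_box (x y z : VSite (bset (cellBox k K₀ (fun μ => Finset.Ico (lo μ) (hi μ))))) :
    min ((kingSliceKernelsRegBox hP1 C lo hi A msq a k K₀).dist x z) ((kingSliceKernelsRegBox hP1 C lo hi A msq a k K₀).dist y z)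
      = P.mesh 0 * min (HiggsLattice.Site.tdist x.1 z.1 : ℝ) (HiggsLattice.Site.tdist y.1 z.1 : ℝ) / P.mesh k := by
  rw [dist_box, dist_box, min_div_div_right (P.mesh_pos k).le, ← mul_min_of_nonneg _ _ (P.mesh_pos 0).le]

/-- ★★ **TRANSFER ON THE BOX**: (2.10) and (2.11)-at-`α` for p26's Hölder box carrier ⇒ `Prop37PrintedAt α` for King's box datum, constants `((d·e^{δd}+2)·Cst, δ)`.
[cite: King1986, Prop 3.7 (3.63)–(3.65) p.663, p.665] [cite: Balaban1983Higgs3, (2.10)–(2.11) p.426] -/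
theorem prop37PrintedAt_box_of (hK₀ : 1 ≤ K₀) (hside : ∀ μ, 2 * ((hi μ - lo μ) * half P k K₀) ≤ P.sitesPerDir 0 μ) {α δ Cst : ℝ}
    (hα0 : 0 ≤ α) (hα1 : α ≤ 1) (hδ : 0 ≤ δ) (hCst : 0 ≤ Cst)
    (h210 : (regBoxKernelsH hP1 C (fun μ => Finset.Ico (lo μ) (hi μ)) A msq a k K₀).Ineq210 δ Cst)
    (h211 : (regBoxKernelsH hP1 C (fun μ => Finset.Ico (lo μ) (hi μ)) A msq a k K₀).Ineq211At α δ Cst) :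
    Prop37PrintedAt α (kingSliceKernelsRegBox hP1 C lo hi A msq a k K₀) (((P.d : ℝ) * Real.exp (δ * P.d) + 2) * Cst) δ := by
  rw [ineq210_iff_BH] at h210
  set K := regBoxKernels hP1 C (fun μ => Finset.Ico (lo μ) (hi μ)) A msq a k K₀ with hK
  set C' : ℝ := ((P.d : ℝ) * Real.exp (δ * P.d) + 2) * Cst with hC'
  have hε : 0 < P.mesh 0 := P.mesh_pos 0
  have hmk : 0 < P.mesh k := P.mesh_pos k
  have hCC' : Cst ≤ C' := by
    rw [hC']
    have : (1 : ℝ) ≤ (P.d : ℝ) * Real.exp (δ * P.d) + 2 := by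
      have : 0 ≤ (P.d : ℝ) * Real.exp (δ * P.d) := by positivity
      linarith
    nlinarith
  intro j _hj
  have hsj : 0 < P.mesh j := P.mesh_pos j
  -- abbreviations for the box points under the bond-closed sites
  refine ⟨fun x y => ⟨?_, fun μ => ?_⟩, fun x b => b.elim, fun x y z hxy => ⟨?_, fun μ => ?_⟩⟩
  · have hb := (h210 j ⟨x.1, (mem_bset.1 x.2).1⟩ ⟨y.1, (mem_bset.1 y.2).1⟩).1
    have e3 : K.dist ⟨x.1, (mem_bset.1 x.2).1⟩ ⟨y.1, (mem_bset.1 y.2).1⟩ = P.mesh 0 * (HiggsLattice.Site.tdist x.1 y.1 : ℝ) := rfl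
    have e4 : (K.d : ℝ) = P.d := rfl
    rw [scaleB_eq, e3, e4] at hb
    show |P.mesh k ^ ((P.d : ℝ) - 2) * K.absG j ⟨x.1, (mem_bset.1 x.2).1⟩ ⟨y.1, (mem_bset.1 y.2).1⟩|
        ≤ C' * (kingSliceKernelsRegBox hP1 C lo hi A msq a k K₀).slice j ^ ((2 : ℝ) - (P.d : ℝ))
          * Real.exp (-(δ * ((kingSliceKernelsRegBox hP1 C lo hi A msq a k K₀).slice j)⁻¹ * (kingSliceKernelsRegBox hP1 C lo hi A msq a k K₀).dist x y))
    rw [abs_of_nonneg (mul_nonneg (Real.rpow_nonneg hmk.le _) (boxAbsG_nonneg j _ _)), dist_box, rate_conv_box]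
    have hsc := scaling_two_box (hP1 := hP1) (C := C) (lo := lo) (hi := hi) (A := A) (msq := msq) (a := a) (k := k) (K₀ := K₀) 0 j
    simp only [add_zero, sub_zero] at hsc
    rw [← hsc]
    calc P.mesh k ^ ((P.d : ℝ) - 2) * K.absG j ⟨x.1, (mem_bset.1 x.2).1⟩ ⟨y.1, (mem_bset.1 y.2).1⟩
        ≤ P.mesh k ^ ((P.d : ℝ) - 2) * (Cst * P.mesh j ^ ((2 : ℝ) - (P.d : ℝ)) *
            Real.exp (-(δ * (P.mesh j)⁻¹ * (P.mesh 0 * (HiggsLattice.Site.tdist x.1 y.1 : ℝ))))) :=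
          mul_le_mul_of_nonneg_left hb (Real.rpow_nonneg hmk.le _)
      _ = Cst * (P.mesh k ^ ((P.d : ℝ) - 2) * P.mesh j ^ ((2 : ℝ) - (P.d : ℝ))) *
            Real.exp (-(δ * (P.mesh j)⁻¹ * (P.mesh 0 * (HiggsLattice.Site.tdist x.1 y.1 : ℝ)))) := by ring
      _ ≤ C' * (P.mesh k ^ ((P.d : ℝ) - 2) * P.mesh j ^ ((2 : ℝ) - (P.d : ℝ))) *
            Real.exp (-(δ * (P.mesh j)⁻¹ * (P.mesh 0 * (HiggsLattice.Site.tdist x.1 y.1 : ℝ)))) :=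
          mul_le_mul_of_nonneg_right (mul_le_mul_of_nonneg_right hCC' (by positivity)) (Real.exp_nonneg _)
  · have hb := (h210 j ⟨x.1, (mem_bset.1 x.2).1⟩ ⟨y.1, (mem_bset.1 y.2).1⟩).2 μ
    have e3 : K.dist ⟨x.1, (mem_bset.1 x.2).1⟩ ⟨y.1, (mem_bset.1 y.2).1⟩ = P.mesh 0 * (HiggsLattice.Site.tdist x.1 y.1 : ℝ) := rfl
    have e4 : (K.d : ℝ) = P.d := rfl
    rw [scaleB_eq, e3, e4] at hb
    show |P.mesh k ^ ((P.d : ℝ) - 1) * K.absDG j μ ⟨x.1, (mem_bset.1 x.2).1⟩ ⟨y.1, (mem_bset.1 y.2).1⟩|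
        ≤ C' * (kingSliceKernelsRegBox hP1 C lo hi A msq a k K₀).slice j ^ ((1 : ℝ) - (P.d : ℝ))
          * Real.exp (-(δ * ((kingSliceKernelsRegBox hP1 C lo hi A msq a k K₀).slice j)⁻¹ * (kingSliceKernelsRegBox hP1 C lo hi A msq a k K₀).dist x y))
    rw [abs_of_nonneg (mul_nonneg (Real.rpow_nonneg hmk.le _) (boxAbsDG_nonneg j μ _ _)), dist_box, rate_conv_box]
    have hsc := scaling_one_box (hP1 := hP1) (C := C) (lo := lo) (hi := hi) (A := A) (msq := msq) (a := a) (k := k) (K₀ := K₀) 0 j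
    simp only [add_zero, sub_zero] at hsc
    rw [← hsc]
    calc P.mesh k ^ ((P.d : ℝ) - 1) * K.absDG j μ ⟨x.1, (mem_bset.1 x.2).1⟩ ⟨y.1, (mem_bset.1 y.2).1⟩
        ≤ P.mesh k ^ ((P.d : ℝ) - 1) * (Cst * P.mesh j ^ ((1 : ℝ) - (P.d : ℝ)) *
            Real.exp (-(δ * (P.mesh j)⁻¹ * (P.mesh 0 * (HiggsLattice.Site.tdist x.1 y.1 : ℝ))))) :=
          mul_le_mul_of_nonneg_left hb (Real.rpow_nonneg hmk.le _)
      _ = Cst * (P.mesh k ^ ((P.d : ℝ) - 1) * P.mesh j ^ ((1 : ℝ) - (P.d : ℝ))) *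
            Real.exp (-(δ * (P.mesh j)⁻¹ * (P.mesh 0 * (HiggsLattice.Site.tdist x.1 y.1 : ℝ)))) := by ring
      _ ≤ C' * (P.mesh k ^ ((P.d : ℝ) - 1) * P.mesh j ^ ((1 : ℝ) - (P.d : ℝ))) *
            Real.exp (-(δ * (P.mesh j)⁻¹ * (P.mesh 0 * (HiggsLattice.Site.tdist x.1 y.1 : ℝ)))) :=
          mul_le_mul_of_nonneg_right (mul_le_mul_of_nonneg_right hCC' (by positivity)) (Real.exp_nonneg _)
  · -- (3.65)₁
    have hne : x.1 ≠ y.1 := ne_of_dist_pos_box hxy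
    have hb := absG_holder_le_box (hP1 := hP1) (C := C) (A := A) (msq := msq) (a := a) hK₀ hside hδ hCst h210 hα0 hα1 j
      ⟨x.1, (mem_bset.1 x.2).1⟩ ⟨y.1, (mem_bset.1 y.2).1⟩ ⟨z.1, (mem_bset.1 z.2).1⟩ hne
    show |((kingSliceKernelsRegBox hP1 C lo hi A msq a k K₀).dist x y) ^ (-α) *
          (P.mesh k ^ ((P.d : ℝ) - 2) * K.absG j ⟨x.1, (mem_bset.1 x.2).1⟩ ⟨z.1, (mem_bset.1 z.2).1⟩
            - P.mesh k ^ ((P.d : ℝ) - 2) * K.absG j ⟨y.1, (mem_bset.1 y.2).1⟩ ⟨z.1, (mem_bset.1 z.2).1⟩)|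
        ≤ C' * (kingSliceKernelsRegBox hP1 C lo hi A msq a k K₀).slice j ^ ((2 : ℝ) - (P.d : ℝ) - α)
          * Real.exp (-(δ * ((kingSliceKernelsRegBox hP1 C lo hi A msq a k K₀).slice j)⁻¹ *
            min ((kingSliceKernelsRegBox hP1 C lo hi A msq a k K₀).dist x z) ((kingSliceKernelsRegBox hP1 C lo hi A msq a k K₀).dist y z)))
    rw [← mul_sub, ← mul_assoc, abs_mul, abs_of_nonneg (mul_nonneg (Real.rpow_nonneg (le_of_lt hxy) _) (Real.rpow_nonneg hmk.le _)),
      min_dist_conv_box, rate_conv_box, ← scaling_two_box α j, hC']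
    have hw := holderWeight_conv_box (hP1 := hP1) (C := C) (lo := lo) (hi := hi) (A := A) (msq := msq) (a := a) (k := k) (K₀ := K₀) (α := α) hne
    set W : ℝ := (kingSliceKernelsRegBox hP1 C lo hi A msq a k K₀).dist x y ^ (-α) with hWdef
    have hW0 : 0 ≤ W := Real.rpow_nonneg (le_of_lt hxy) _
    set E : ℝ := Real.exp (-(δ * (P.mesh j)⁻¹ * (P.mesh 0 * min (HiggsLattice.Site.tdist x.1 z.1 : ℝ) (HiggsLattice.Site.tdist y.1 z.1 : ℝ)))) with hE
    calc W * P.mesh k ^ ((P.d : ℝ) - 2) * |K.absG j ⟨x.1, (mem_bset.1 x.2).1⟩ ⟨z.1, (mem_bset.1 z.2).1⟩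
            - K.absG j ⟨y.1, (mem_bset.1 y.2).1⟩ ⟨z.1, (mem_bset.1 z.2).1⟩|
        ≤ W * P.mesh k ^ ((P.d : ℝ) - 2) * (((P.d : ℝ) * Real.exp (δ * P.d) + 2) * Cst *
            (P.mesh 0 * (HiggsLattice.Site.tdist x.1 y.1 : ℝ)) ^ α * P.mesh j ^ ((2 : ℝ) - (P.d : ℝ) - α) * E) :=
          mul_le_mul_of_nonneg_left hb (mul_nonneg hW0 (Real.rpow_nonneg hmk.le _))
      _ = ((P.d : ℝ) * Real.exp (δ * P.d) + 2) * Cst *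
            ((W * (P.mesh 0 * (HiggsLattice.Site.tdist x.1 y.1 : ℝ)) ^ α) * P.mesh k ^ ((P.d : ℝ) - 2) * P.mesh j ^ ((2 : ℝ) - (P.d : ℝ) - α)) * E := by
          ring
      _ = ((P.d : ℝ) * Real.exp (δ * P.d) + 2) * Cst *
            (P.mesh k ^ ((P.d : ℝ) - 2 + α) * P.mesh j ^ ((2 : ℝ) - (P.d : ℝ) - α)) * E := by
          rw [hWdef, hw, mul_comm (P.mesh k ^ α), ← Real.rpow_add hmk]
  · -- (3.65)₂
    have hne : x.1 ≠ y.1 := ne_of_dist_pos_box hxy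
    have hb := absDG_holder_le_box (hP1 := hP1) (C := C) (A := A) (msq := msq) (a := a) hK₀ hside h211 j μ
      ⟨x.1, (mem_bset.1 x.2).1⟩ ⟨y.1, (mem_bset.1 y.2).1⟩ ⟨z.1, (mem_bset.1 z.2).1⟩ hne ((mem_bset.1 x.2).2 μ) ((mem_bset.1 y.2).2 μ)
    show |((kingSliceKernelsRegBox hP1 C lo hi A msq a k K₀).dist x y) ^ (-α) *
          (P.mesh k ^ ((P.d : ℝ) - 1) * K.absDG j μ ⟨x.1, (mem_bset.1 x.2).1⟩ ⟨z.1, (mem_bset.1 z.2).1⟩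
            - P.mesh k ^ ((P.d : ℝ) - 1) * K.absDG j μ ⟨y.1, (mem_bset.1 y.2).1⟩ ⟨z.1, (mem_bset.1 z.2).1⟩)|
        ≤ C' * (kingSliceKernelsRegBox hP1 C lo hi A msq a k K₀).slice j ^ ((1 : ℝ) - (P.d : ℝ) - α)
          * Real.exp (-(δ * ((kingSliceKernelsRegBox hP1 C lo hi A msq a k K₀).slice j)⁻¹ *
            min ((kingSliceKernelsRegBox hP1 C lo hi A msq a k K₀).dist x z) ((kingSliceKernelsRegBox hP1 C lo hi A msq a k K₀).dist y z)))
    rw [← mul_sub, ← mul_assoc, abs_mul, abs_of_nonneg (mul_nonneg (Real.rpow_nonneg (le_of_lt hxy) _) (Real.rpow_nonneg hmk.le _)),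
      min_dist_conv_box, rate_conv_box, ← scaling_one_box α j]
    have hw := holderWeight_conv_box (hP1 := hP1) (C := C) (lo := lo) (hi := hi) (A := A) (msq := msq) (a := a) (k := k) (K₀ := K₀) (α := α) hne
    set W : ℝ := (kingSliceKernelsRegBox hP1 C lo hi A msq a k K₀).dist x y ^ (-α) with hWdef
    have hW0 : 0 ≤ W := Real.rpow_nonneg (le_of_lt hxy) _
    set E : ℝ := Real.exp (-(δ * (P.mesh j)⁻¹ * (P.mesh 0 * min (HiggsLattice.Site.tdist x.1 z.1 : ℝ) (HiggsLattice.Site.tdist y.1 z.1 : ℝ)))) with hE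
    calc W * P.mesh k ^ ((P.d : ℝ) - 1) * |K.absDG j μ ⟨x.1, (mem_bset.1 x.2).1⟩ ⟨z.1, (mem_bset.1 z.2).1⟩
            - K.absDG j μ ⟨y.1, (mem_bset.1 y.2).1⟩ ⟨z.1, (mem_bset.1 z.2).1⟩|
        ≤ W * P.mesh k ^ ((P.d : ℝ) - 1) * (Cst * (P.mesh 0 * (HiggsLattice.Site.tdist x.1 y.1 : ℝ)) ^ α * P.mesh j ^ ((1 : ℝ) - (P.d : ℝ) - α) * E) :=
          mul_le_mul_of_nonneg_left hb (mul_nonneg hW0 (Real.rpow_nonneg hmk.le _))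
      _ = Cst * ((W * (P.mesh 0 * (HiggsLattice.Site.tdist x.1 y.1 : ℝ)) ^ α) * P.mesh k ^ ((P.d : ℝ) - 1) * P.mesh j ^ ((1 : ℝ) - (P.d : ℝ) - α)) * E := by
          ring
      _ = Cst * (P.mesh k ^ ((P.d : ℝ) - 1 + α) * P.mesh j ^ ((1 : ℝ) - (P.d : ℝ) - α)) * E := by
          rw [hWdef, hw, mul_comm (P.mesh k ^ α), ← Real.rpow_add hmk]
      _ ≤ C' * (P.mesh k ^ ((P.d : ℝ) - 1 + α) * P.mesh j ^ ((1 : ℝ) - (P.d : ℝ) - α)) * E :=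
          mul_le_mul_of_nonneg_right (mul_le_mul_of_nonneg_right hCC' (by positivity)) (Real.exp_nonneg _)

/-- ★★★ **KING 1986 PROPOSITION 3.7 BY NAME FOR `G^η_{(j)}(Ω′, A)` — A REGULAR BACKGROUND ON A BIG-BLOCK INTERVAL BOX `Ω′`, regularity required ON `Ω′`
ONLY, KING's ORDER**: there is a cube-size threshold `K₀min`, and for every `α ∈ (0, 1)` and every cube size `K₀ ≥ K₀min` constants `t, C, δ₀ > 0`, such that on
every volume `P` of [Ba1] (1.2) with `P.d = d`, `P.L = L`, `K₀ ∣ M`, every level `1 ≤ k ≤ K_P` with `3L^kK₀ ≤ |T_ε|_μ`, `L^kε ≤ 1`, every interval box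
`Ω′ = Π_μ[lo_μK₀L^k, hi_μK₀L^k)` with sides at most half the torus, and every field `A` with one-step differences `≤ δ_A` ON `Ω′` and `L^k·δ_A·|e| ≤ t`:
`Prop37PrintedAt α (kingSliceKernelsRegBox hP1 C lo hi A m² a k K₀) C δ₀`. [cite: King1986, Prop 3.7 (3.63)–(3.65) p.663, p.665 l.22–23, p.661]
[cite: Balaban1983Higgs3, (2.10)–(2.11) p.426] [cite: Balaban1982Higgs1, Prop. 2.1 p.610, p.611 l.1–2, (2.43) p.612] -/
theorem prop37PrintedAt_king_regularField_box (d L : ℕ) (hd : 1 ≤ d) (hL : 2 ≤ L) {a msq : ℝ} (ha : 0 < a) (hmsq : 0 < msq)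
    (N : ℕ) (C : ChargeData N) :
    ∃ K₀min : ℕ, ∀ {α : ℝ}, 0 < α → α < 1 → ∀ K₀ : ℕ, K₀min ≤ K₀ → ∃ t Cst δ₀ : ℝ, 0 < t ∧ 0 < Cst ∧ 0 < δ₀ ∧
      ∀ (P : HiggsLattice.Params) (hP1 : 1 < P.L), P.d = d → P.L = L → K₀ ∣ P.M →
      ∀ {k : ℕ}, 1 ≤ k → k ≤ P.K → (∀ μ, 3 * half P k K₀ ≤ P.sitesPerDir 0 μ) → P.mesh k ≤ 1 →
      ∀ (lo hi : Fin P.d → ℕ), (∀ μ, 2 * ((hi μ - lo μ) * half P k K₀) ≤ P.sitesPerDir 0 μ) →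
      ∀ (A : HiggsLattice.VecField P 0) {δA : ℝ}, 0 ≤ δA →
        (∀ z ∈ cellBox k K₀ (fun μ => Finset.Ico (lo μ) (hi μ)), ∀ μ ν : Fin P.d, |A ⟨z.shift ν, μ⟩ - A ⟨z, μ⟩| ≤ δA) →
        (P.L : ℝ) ^ k * δA * |C.e| ≤ t →
        Prop37PrintedAt α (kingSliceKernelsRegBox hP1 C lo hi A msq a k K₀) Cst δ₀ := by
  obtain ⟨K₀min, h⟩ := ineq210_and_211At_regularBoxH_small d L hd hL ha hmsq N C
  refine ⟨max K₀min 1, fun {α} hα0 hα1 K₀ hK₀ => ?_⟩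
  have hK₀1 : 1 ≤ K₀ := (le_max_right _ _).trans hK₀
  obtain ⟨t, δ₁, Cst, ht, hδ₁, hCst, h'⟩ := h hα0.le hα1 K₀ ((le_max_left _ _).trans hK₀)
  refine ⟨t, ((d : ℝ) * Real.exp (δ₁ * d) + 2) * Cst, δ₁, ht, mul_pos (by positivity) hCst, hδ₁, ?_⟩
  intro P hP1 hPd hPL hK₀M k hk1 hkK h3 hmesh lo hi hside A δA hδA hreg hle
  obtain ⟨h210, h211⟩ := h' P hP1 hPd hPL hK₀M hk1 hkK h3 hmesh (fun μ => Finset.Ico (lo μ) (hi μ)) A hδA hreg hle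
  have hmain := prop37PrintedAt_box_of (hP1 := hP1) (C := C) (lo := lo) (hi := hi) (A := A) (msq := msq) (a := a) (k := k)
    hK₀1 hside hα0.le hα1.le hδ₁.le hCst.le h210 h211
  subst hPd
  exact hmain

/-- ★★★ **`Prop37KingOrder` FOR `G^η_{(j)}(Ω′, A)` AT EVERY FIELD LATTICE-CONSTANT ON THE BOX** (arbitrary outside `Ω′`): King's print-order schema for
the box datum, all `α` at once (the box threshold `t(α, K₀)` is met with `δ_A = 0`). [cite: King1986, Prop 3.7 p.663, p.665] [cite: Balaban1983Higgs3, (2.10)–(2.11) p.426] -/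
theorem prop37KingOrder_king_flatOnBox (d L : ℕ) (hd : 1 ≤ d) (hL : 2 ≤ L) {a msq : ℝ} (ha : 0 < a) (hmsq : 0 < msq)
    (N : ℕ) (C : ChargeData N) :
    ∃ K₀min : ℕ, ∀ K₀ : ℕ, K₀min ≤ K₀ →
      ∀ (P : HiggsLattice.Params) (hP1 : 1 < P.L), P.d = d → P.L = L → K₀ ∣ P.M →
      ∀ {k : ℕ}, 1 ≤ k → k ≤ P.K → (∀ μ, 3 * half P k K₀ ≤ P.sitesPerDir 0 μ) → P.mesh k ≤ 1 →
      ∀ (lo hi : Fin P.d → ℕ), (∀ μ, 2 * ((hi μ - lo μ) * half P k K₀) ≤ P.sitesPerDir 0 μ) →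
      ∀ (A : HiggsLattice.VecField P 0),
        (∀ z ∈ cellBox k K₀ (fun μ => Finset.Ico (lo μ) (hi μ)), ∀ μ ν : Fin P.d, A ⟨z.shift ν, μ⟩ = A ⟨z, μ⟩) →
        Prop37KingOrder (kingSliceKernelsRegBox hP1 C lo hi A msq a k K₀) := by
  obtain ⟨K₀min, h⟩ := prop37PrintedAt_king_regularField_box d L hd hL ha hmsq N C
  refine ⟨K₀min, fun K₀ hK₀ P hP1 hPd hPL hK₀M k hk1 hkK h3 hmesh lo hi hside A hflat α hα0 hα1 => ?_⟩
  obtain ⟨t, Cst, δ₀, ht, _hCst, hδ₀, h'⟩ := h hα0 hα1 K₀ hK₀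
  refine ⟨Cst, δ₀, hδ₀, ?_⟩
  refine h' P hP1 hPd hPL hK₀M hk1 hkK h3 hmesh lo hi hside A (δA := 0) le_rfl (fun z hz μ ν => ?_) ?_
  · rw [hflat z hz μ ν, sub_self, abs_zero]
  · rw [mul_zero, zero_mul]; exact ht.le

end MainBox

end Summit.QuantumFields.YangMills.BalabanUVNodes.N15KingModelRung.RegularField

end
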